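import Literature.Barriers.QuantumAdvantage.TensorNetworkContractionEngineValue
import Literature.Barriers.QuantumAdvantage.TensorNetworkContractionRecordsFP
import Literature.Barriers.QuantumAdvantage.TensorNetworkContractionPathDecompositionFP
import Literature.Barriers.QuantumAdvantage.TensorNetworkContractionAssembly
import HarnessLib

/-!
# Barrier catalogue `QuantumAdvantage` — the contraction engine in polynomial time: Markov–Shi Thm 4.6 and Prop 5.1 discharged

Companion to `TensorNetworkContractionEngineValue.lean` (`engineOut`: the exact probability
`(u, v, 2^h)`, `p · 2^h = u + v√2`, computed by the junction-tree evaluation of the integer records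
of the segment network along the listed segment decomposition; `engineOut_spec`),
`TensorNetworkContractionRecordsFP.lean` / `ZOmegaCodeRing.lean` / `JunctionTreeFP.lean` (the
junction-tree evaluation over `ℤ[ω]` on codes, `JT.dpValueFP`) and
`TensorNetworkContractionAssembly.lean` (`ContractionEngine`, `markovShi2008_thm46_of_engine`).
We realise `engineOut` on the code of the engine's input
`⟨x, ⟨sigmaEncode ⟨|x|, m, C⟩, ⟨D.encode, y⟩⟩⟩` (`engineTFP`), obtaining the engine
(**`jtEngine : ContractionEngine`**) and hence **`markovShi2008_thm46_holds`** (Thm 4.6 with the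
decomposition supplied) and, with the path-decomposition supplier of
`TensorNetworkContractionPathDecompositionFP.lean`, **`markovShi2008_prop51_holds`** (Prop 5.1
with the ordering supplied).

## References

* [MarkovShi2008] I. L. Markov, Y. Shi, SIAM J. Comput. 38 (2008) 963–981, §4 (Thm 4.6 and its
  proof, Prop 4.2, Lemma 4.4), §3 (Prop 3.5, Def 3.2), §5 (Prop 5.1).
* S. Arora, B. Barak, *Computational Complexity*, CUP 2009, §1.3 (closure of polynomial time).
-/

noncomputable section

namespace Literature.Barriers.QuantumAdvantage

open Literature.Computability.Cryptography Literature.Computability.QuantumComplexity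
  Literature.Computability.QuantumComplexity.ZOmega
  Literature.Combinatorics.SimpleGraph Literature.Combinatorics.SimpleGraph.ListTD
  Literature.LinearAlgebra.TensorNetworks Literature.LinearAlgebra.TensorNetworks.JT
  Literature.Computability.Complexity Literature.Computability.Complexity.CodeFP
  Literature.Computability.Complexity.Brick Polynomial _root_.Computability PathFP

namespace EngineFP

/-! ### Gate kinds from gate codes -/

/-- **The kind of a gate is read off its code**: tag `1` ↦ `6` (oracle), else `1 +` the symbol numeral.
[cite: AroraBarak2009, §1.3] -/
theorem opKindFP : CodeFP sgateE natE (fun x : SGate => opKind x.2) := by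
  have htag : CodeFP strE bitE (fun w => decide (w.take 1 = [true])) :=
    (CodeFP.eq (eα := strE) (fun a b h => h)).comp ((strTake.comp ((const _ 1).pair (CodeFP.id strE))).pair (const _ [true]))
  have hdrop : CodeFP strE strE (fun w => w.drop 1) := strDrop.comp ((const _ 1).pair (CodeFP.id strE))
  have hfst : CodeFP strE strE (fun w => fstF (w.drop 1)) := (of_fn (eα := strE) (eβ := strE) fstF fstF_mem_FP fun _ => rfl).comp hdrop
  have hval : CodeFP strE natE (fun w => bitsToNat (fstF (w.drop 1)) + 1) := natAdd.comp ((strVal.comp hfst).pair (const _ 1))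
  obtain ⟨F, hF, hFs⟩ := htag.ite (const _ 6) hval
  refine ⟨F, hF, fun x => ?_⟩
  obtain ⟨N, g⟩ := x
  have h := hFs g.encode
  simp only [strE, id] at h
  rw [show sgateE ⟨N, g⟩ = g.encode from rfl, h]
  cases g with
  | gate op e =>
    show _ = natE (opKind (QGate.gate op e))
    rw [opKind_gate]
    simp only [QGate.encode, List.take_succ_cons, List.take_zero, List.cons.injEq, Bool.false_eq_true, false_and,
      decide_false, Bool.false_eq_true, if_false, List.drop_succ_cons, List.drop_zero, fstF_boolPair, bitsToNat_encodeNat]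
    rfl
  | oracle k e =>
    show _ = natE (opKind (QGate.oracle k e))
    simp [QGate.encode, opKind]

/-! ### The segment numbering on codes -/

/-- `canonL` on codes (input `((wl, w), t)`). [cite: AroraBarak2009, §1.3] -/
theorem canonLFP : CodeFP (pairE (pairE (rawE (rawE natE)) natE) natE) natE (fun p => canonL p.1.1 p.1.2 p.2) := by
  have hg : CodeFP (pairE (pairE (rawE (rawE natE)) natE) natE) (rawE natE) (fun p => gateTimesOn p.1.1 p.1.2) :=
    gateTimesOnFP.comp (fst _ _)
  have hfilt := filter (σ := ℕ) (eσ := natE) (eα := natE) (p := fun q => decide (q.2 + 1 ≤ q.1))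
    (natLe.comp ((natAdd.comp ((snd _ _).pair (const _ 1))).pair (fst _ _)))
  have hS : CodeFP (pairE (pairE (rawE (rawE natE)) natE) natE) (rawE natE)
      (fun p => (gateTimesOn p.1.1 p.1.2).filter fun t' => decide (t' + 1 ≤ p.2)) := (hfilt.comp ((snd _ _).pair hg)).congr fun _ => rfl
  have hlast := rawGetLast?.comp hS
  have hcase := optCases (σ := Unit) (eσ := unitE) (eα := natE) (eδ := natE)
    (k := fun _ o => match o with | some t' => t' + 1 | none => 0) (gnone := fun _ => 0) (gsome := fun t => t.2 + 1)
    (const _ 0) (natAdd.comp ((snd _ _).pair (const _ 1))) (fun _ => rfl) (fun _ _ => rfl)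
  refine ((hcase.comp ((const _ ()).pair hlast)).congr fun p => ?_)
  show (match ((gateTimesOn p.1.1 p.1.2).filter fun t' => decide (t' + 1 ≤ p.2)).getLast? with
    | some t' => t' + 1 | none => 0) = canonL p.1.1 p.1.2 p.2
  unfold canonL
  rcases ((gateTimesOn p.1.1 p.1.2).filter fun t' => decide (t' + 1 ≤ p.2)).getLast? with _ | t <;> rfl

/-- `canonBounds` on codes (input `(wl, w)`). [cite: AroraBarak2009, §1.3] -/
theorem canonBoundsFP : CodeFP (pairE (rawE (rawE natE)) natE) (rawE natE) (fun p => canonBounds p.1 p.2) := by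
  have hm := map (σ := Unit) (eσ := unitE) (eα := natE) (eβ := natE) (g := fun t => t.2 + 1) (natAdd.comp ((snd _ _).pair (const _ 1)))
  exact ((rawCons natE).comp ((const _ 0).pair (hm.comp ((const _ ()).pair gateTimesOnFP)))).congr fun p => rfl

/-- `segPairs` on codes (input `(wl, N)`, `N` unary). [cite: AroraBarak2009, §1.3] -/
theorem segPairsFP : CodeFP (pairE (rawE (rawE natE)) unE) (rawE (pairE natE natE)) (fun p => segPairs p.1 p.2) := by
  -- the row of wire `w`
  have hrow : CodeFP (pairE (rawE (rawE natE)) natE) (rawE (pairE natE natE)) (fun q => (canonBounds q.1 q.2).map fun b => (q.2, b)) := by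
    have hm := map (σ := ℕ) (eσ := natE) (eα := natE) (eβ := pairE natE natE) (g := fun t => (t.1, t.2)) ((CodeFP.id _).congr fun t => rfl)
    exact (hm.comp ((snd _ _).pair canonBoundsFP)).congr fun q => rfl
  have hrows := map hrow
  refine (((flatten (pairE natE natE)).comp (hrows.comp ((fst _ _).pair (urange.comp (snd _ _))))).congr fun p => ?_)
  rw [segPairs, List.flatMap_def]

/-- **`segNum` on codes** (input `((wl, N), (w, b))`). [cite: AroraBarak2009, §1.3] -/
theorem segNumFP : CodeFP (pairE (pairE (rawE (rawE natE)) unE) (pairE natE natE)) natE (fun p => segNum p.1.1 p.1.2 p.2.1 p.2.2) := by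
  have h := findIdxFP (σ := ℕ × ℕ) (eσ := pairE natE natE) (eα := pairE natE natE) (p := fun q => q.2 == q.1)
    ((beq (pairE_injective natE_injective natE_injective)).comp ((snd _ _).pair (fst _ _)))
  refine ((h.comp ((snd _ _).pair (segPairsFP.comp (fst _ _)))).congr fun p => ?_)
  rfl

/-- The code of the static data `(wl, N)` (`N` unary). [folklore] -/
abbrev wnE : List (List ℕ) × ℕ → List Bool := pairE (rawE (rawE natE)) unE

/-- `segNum w (canonL w t)` on codes (input `((wl, N), (w, t))`). [folklore] -/
theorem segNumCanonFP : CodeFP (pairE wnE (pairE natE natE)) natE (fun p => segNum p.1.1 p.1.2 p.2.1 (canonL p.1.1 p.2.1 p.2.2)) := by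
  have hcan := canonLFP.comp (((fst wnE (pairE natE natE)).fst'.pair (snd wnE (pairE natE natE)).fst').pair
    (snd wnE (pairE natE natE)).snd')
  have h := segNumFP.comp ((fst wnE (pairE natE natE)).pair ((snd wnE (pairE natE natE)).fst'.pair hcan))
  exact h.congr fun _ => rfl

/-- **`scopeNums` on codes** (input `((wl, N), c)`). [cite: AroraBarak2009, §1.3] -/
theorem scopeNumsFP : CodeFP (pairE wnE natE) (rawE natE) (fun p => scopeNums p.1.1 p.1.2 p.2) := by
  have hwl : CodeFP (pairE wnE natE) (rawE (rawE natE)) (fun p => p.1.1) := (fst _ _).fst'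
  have hN : CodeFP (pairE wnE natE) natE (fun p => p.1.2) := (natOfUn.comp (fst _ _).snd').congr fun _ => rfl
  have hc : CodeFP (pairE wnE natE) natE (fun p => p.2) := snd _ _
  have hT : CodeFP (pairE wnE natE) natE (fun p => p.1.1.length) := (natLength _).comp hwl
  have ht : CodeFP (pairE wnE natE) natE (fun p => p.2 - p.1.2) := natSub.comp (hc.pair hN)
  have hw : CodeFP (pairE wnE natE) natE (fun p => p.2 - p.1.2 - p.1.1.length) := natSub.comp (ht.pair hT)
  -- input branch
  have hin0 := (rawSingleton natE).comp (segNumFP.comp ((fst wnE natE).pair (hc.pair (const _ 0))))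
  have hin : CodeFP (pairE wnE natE) (rawE natE) (fun p => [segNum p.1.1 p.1.2 p.2 0]) := hin0.congr fun _ => rfl
  -- output branch
  have hout0 := (rawSingleton natE).comp (segNumCanonFP.comp ((fst wnE natE).pair (hw.pair hT)))
  have hout : CodeFP (pairE wnE natE) (rawE natE)
      (fun p => [segNum p.1.1 p.1.2 (p.2 - p.1.2 - p.1.1.length) (canonL p.1.1 (p.2 - p.1.2 - p.1.1.length) p.1.1.length)]) :=
    hout0.congr fun _ => rfl
  -- gate branch: over the wires of gate `t`, context `((wl, N), t)`
  have hp1 := segNumCanonFP.comp ((fst (pairE wnE natE) natE).fst'.pair ((snd (pairE wnE natE) natE).pair (fst (pairE wnE natE) natE).snd'))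
  have hp2 := segNumCanonFP.comp ((fst (pairE wnE natE) natE).fst'.pair ((snd (pairE wnE natE) natE).pair
    (natAdd.comp ((fst (pairE wnE natE) natE).snd'.pair (const _ 1)))))
  have hpair0 := (rawCons natE).comp (hp1.pair ((rawSingleton natE).comp hp2))
  have hpair : CodeFP (pairE (pairE wnE natE) natE) (rawE natE)
      (fun q => [segNum q.1.1.1 q.1.1.2 q.2 (canonL q.1.1.1 q.2 q.1.2), segNum q.1.1.1 q.1.1.2 q.2 (canonL q.1.1.1 q.2 (q.1.2 + 1))]) :=
    hpair0.congr fun _ => rfl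
  have hws0 := wlGetFP.comp (hwl.pair ht)
  have hws : CodeFP (pairE wnE natE) (rawE natE) (fun p => p.1.1.getD (p.2 - p.1.2) []) := hws0.congr fun _ => rfl
  have hgate0 := (flatten natE).comp ((map hpair).comp (((fst wnE natE).pair ht).pair hws))
  have hgate : CodeFP (pairE wnE natE) (rawE natE)
      (fun p => (p.1.1.getD (p.2 - p.1.2) []).flatMap fun w =>
        [segNum p.1.1 p.1.2 w (canonL p.1.1 w (p.2 - p.1.2)), segNum p.1.1 p.1.2 w (canonL p.1.1 w (p.2 - p.1.2 + 1))]) :=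
    hgate0.congr fun p => by rw [List.flatMap_def]
  -- dispatch
  have h1 : CodeFP (pairE wnE natE) bitE (fun p => decide (p.2 < p.1.2)) := natLt.comp (hc.pair hN)
  have h2 : CodeFP (pairE wnE natE) bitE (fun p => decide (p.2 < p.1.2 + p.1.1.length)) := natLt.comp (hc.pair (natAdd.comp (hN.pair hT)))
  refine (h1.ite hin (h2.ite hgate hout)).congr fun p => ?_
  simp only [scopeNums, decide_eq_true_eq]

/-- **`segBagOf` on codes** (input `((wl, N), codes)`). [cite: AroraBarak2009, §1.3] -/
theorem segBagOfFP : CodeFP (pairE wnE (rawE natE)) (rawE natE) (fun p => segBagOf p.1.1 p.1.2 p.2) := by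
  have hm := map scopeNumsFP
  refine ((sortDedupFP.comp ((flatten natE).comp hm)).congr fun p => ?_)
  rw [segBagOf, List.flatMap_def]

/-! ### The records on codes -/

/-- The code of the record data `(wl, (N, (ops, xb)))` (`N` unary, `xb` the input bits as a string).
[folklore] -/
abbrev rdE : List (List ℕ) × (ℕ × (List ℕ × List Bool)) → List Bool := pairE (rawE (rawE natE)) (pairE unE (pairE (rawE natE) strE))

/-- Reading a bit of a string by a binary index, default `false`. [folklore] -/
theorem getD_eq_decide : ∀ (x : List Bool) (c : ℕ), x.getD c false = decide ((x.drop c).take 1 = [true])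
  | [], c => by simp
  | b :: x, 0 => by cases b <;> simp
  | b :: x, c + 1 => by rw [List.getD_cons_succ, List.drop_succ_cons]; exact getD_eq_decide x c

/-- **A bit of the input string by a binary index** (input `(x, c)`). [cite: AroraBarak2009, §1.3] -/
theorem strGetDFP : CodeFP (pairE strE natE) bitE (fun p => p.1.getD p.2 false) := by
  have hu : CodeFP (pairE strE natE) unE (fun p => min p.2 p.1.length) := unOfNatMin.comp ((strLength.comp (fst _ _)).pair (snd _ _))
  have hdrop : CodeFP (pairE strE natE) strE (fun p => p.1.drop (min p.2 p.1.length)) := strDrop.comp (hu.pair (fst _ _))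
  have htake : CodeFP (pairE strE natE) strE (fun p => (p.1.drop (min p.2 p.1.length)).take 1) := strTake.comp ((const _ 1).pair hdrop)
  refine (((CodeFP.eq (eα := strE) fun a b h => h).comp (htake.pair (const _ [true]))).congr fun p => ?_)
  obtain ⟨x, c⟩ := p
  show decide ((x.drop (min c x.length)).take 1 = [true]) = x.getD c false
  rw [getD_eq_decide]
  rcases le_total c x.length with h | h
  · rw [min_eq_left h]
  · rw [min_eq_right h, List.drop_length, List.drop_of_length_le h]

/-- The kind of `recOfCode`. [folklore] -/
theorem kind_recOfCode (wl : List (List ℕ)) (N : ℕ) (ops : List ℕ) (xb : List Bool) (c : ℕ) :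
    (recOfCode wl N ops xb c).kind =
      if c < N then 0 else if c < N + wl.length then
        (if ops.getD (c - N) 6 = 1 then 1 else if ops.getD (c - N) 6 = 2 then 2 else if ops.getD (c - N) 6 = 3 then 3
          else if ops.getD (c - N) 6 = 4 then 4 else 6)
      else 5 := by
  unfold recOfCode
  split_ifs <;> rfl

/-- The flag of `recOfCode`. [folklore] -/
theorem flag_recOfCode (wl : List (List ℕ)) (N : ℕ) (ops : List ℕ) (xb : List Bool) (c : ℕ) :
    (recOfCode wl N ops xb c).flag =
      if c < N then xb.getD c false else if c < N + wl.length then false else decide (c - N - wl.length = 0) := by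
  unfold recOfCode
  split_ifs <;> rfl

/-- The scope of `recOfCode`. [folklore] -/
theorem scope_recOfCode (wl : List (List ℕ)) (N : ℕ) (ops : List ℕ) (xb : List Bool) (c : ℕ) :
    (recOfCode wl N ops xb c).scope =
      if c < N then [segNum wl N c 0] else if c < N + wl.length then
        (if ops.getD (c - N) 6 = 1 ∨ ops.getD (c - N) 6 = 2 ∨ ops.getD (c - N) 6 = 3 then
          [segNum wl N ((wl.getD (c - N) []).getD 0 0) (canonL wl ((wl.getD (c - N) []).getD 0 0) (c - N)),
            segNum wl N ((wl.getD (c - N) []).getD 0 0) (canonL wl ((wl.getD (c - N) []).getD 0 0) (c - N + 1))]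
        else if ops.getD (c - N) 6 = 4 then
          [segNum wl N ((wl.getD (c - N) []).getD 0 0) (canonL wl ((wl.getD (c - N) []).getD 0 0) (c - N)),
            segNum wl N ((wl.getD (c - N) []).getD 1 0) (canonL wl ((wl.getD (c - N) []).getD 1 0) (c - N)),
            segNum wl N ((wl.getD (c - N) []).getD 0 0) (canonL wl ((wl.getD (c - N) []).getD 0 0) (c - N + 1)),
            segNum wl N ((wl.getD (c - N) []).getD 1 0) (canonL wl ((wl.getD (c - N) []).getD 1 0) (c - N + 1))]
        else [])
      else [segNum wl N (c - N - wl.length) (canonL wl (c - N - wl.length) wl.length)] := by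
  unfold recOfCode
  by_cases h1 : c < N
  · rw [if_pos h1, if_pos h1]; rfl
  rw [if_neg h1, if_neg h1]
  by_cases h2 : c < N + wl.length
  · rw [if_pos h2, if_pos h2]
    by_cases k1 : ops.getD (c - N) 6 = 1
    · rw [if_pos k1, if_pos (Or.inl k1)]; rfl
    rw [if_neg k1]
    by_cases k2 : ops.getD (c - N) 6 = 2
    · rw [if_pos k2, if_pos (Or.inr (Or.inl k2))]; rfl
    rw [if_neg k2]
    by_cases k3 : ops.getD (c - N) 6 = 3
    · rw [if_pos k3, if_pos (Or.inr (Or.inr k3))]; rfl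
    rw [if_neg k3]
    have hk123 : ¬ (ops.getD (c - N) 6 = 1 ∨ ops.getD (c - N) 6 = 2 ∨ ops.getD (c - N) 6 = 3) := by tauto
    rw [if_neg hk123]
    by_cases k4 : ops.getD (c - N) 6 = 4
    · rw [if_pos k4, if_pos k4]; rfl
    · rw [if_neg k4, if_neg k4]; rfl
  · rw [if_neg h2, if_neg h2]; rfl

/-- **The record of a node on codes** (input `(data, c)`): its kind, flag and scope computed
separately (`recE` = the code of that triple). [cite: AroraBarak2009, §1.3] -/
theorem recOfCodeFP : CodeFP (pairE rdE natE) NodeRec.recE (fun p => recOfCode p.1.1 p.1.2.1 p.1.2.2.1 p.1.2.2.2 p.2) := by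
  -- projections
  have hwl : CodeFP (pairE rdE natE) (rawE (rawE natE)) (fun p => p.1.1) := (fst _ _).fst'
  have hNu : CodeFP (pairE rdE natE) unE (fun p => p.1.2.1) := (fst _ _).snd'.fst'
  have hN : CodeFP (pairE rdE natE) natE (fun p => p.1.2.1) := (natOfUn.comp hNu).congr fun _ => rfl
  have hops : CodeFP (pairE rdE natE) (rawE natE) (fun p => p.1.2.2.1) := (fst _ _).snd'.snd'.fst'
  have hxb : CodeFP (pairE rdE natE) strE (fun p => p.1.2.2.2) := (fst _ _).snd'.snd'.snd'
  have hc : CodeFP (pairE rdE natE) natE (fun p => p.2) := snd _ _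
  have hT : CodeFP (pairE rdE natE) natE (fun p => p.1.1.length) := (natLength _).comp hwl
  have ht : CodeFP (pairE rdE natE) natE (fun p => p.2 - p.1.2.1) := natSub.comp (hc.pair hN)
  have hw' : CodeFP (pairE rdE natE) natE (fun p => p.2 - p.1.2.1 - p.1.1.length) := natSub.comp (ht.pair hT)
  -- the kind of gate `t` (`getD` with default `6`, through the default-`0` reader)
  have hk0 : CodeFP (pairE rdE natE) natE (fun p => p.1.2.2.1.getD (p.2 - p.1.2.1) 0) := (rawGetD natE (d := 0) rfl).comp (hops.pair ht)
  have hk : CodeFP (pairE rdE natE) natE (fun p => p.1.2.2.1.getD (p.2 - p.1.2.1) 6) := by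
    refine ((natLt.comp (ht.pair ((natLength _).comp hops))).ite hk0 (const _ 6)).congr fun p => ?_
    simp only [decide_eq_true_eq]
    split_ifs with h
    · rw [List.getD_eq_getElem?_getD, List.getD_eq_getElem?_getD, List.getElem?_eq_getElem h]; rfl
    · rw [List.getD_eq_getElem?_getD, List.getElem?_eq_none (not_lt.1 h)]; rfl
  have hkEq : ∀ j : ℕ, CodeFP (pairE rdE natE) bitE (fun p => decide (p.1.2.2.1.getD (p.2 - p.1.2.1) 6 = j)) :=
    fun j => natEq.comp (hk.pair (const _ j))
  have h1 : CodeFP (pairE rdE natE) bitE (fun p => decide (p.2 < p.1.2.1)) := natLt.comp (hc.pair hN)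
  have h2 : CodeFP (pairE rdE natE) bitE (fun p => decide (p.2 < p.1.2.1 + p.1.1.length)) := natLt.comp (hc.pair (natAdd.comp (hN.pair hT)))
  -- kind
  have hkind : CodeFP (pairE rdE natE) natE (fun p => (recOfCode p.1.1 p.1.2.1 p.1.2.2.1 p.1.2.2.2 p.2).kind) := by
    refine (h1.ite (const _ 0) (h2.ite ((hkEq 1).ite (const _ 1) ((hkEq 2).ite (const _ 2) ((hkEq 3).ite (const _ 3)
      ((hkEq 4).ite (const _ 4) (const _ 6))))) (const _ 5))).congr fun p => ?_
    rw [kind_recOfCode]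
    simp only [decide_eq_true_eq]
  -- flag
  have hflag : CodeFP (pairE rdE natE) bitE (fun p => (recOfCode p.1.1 p.1.2.1 p.1.2.2.1 p.1.2.2.2 p.2).flag) := by
    refine (h1.ite (strGetDFP.comp (hxb.pair hc)) (h2.ite (const _ false) (natEq.comp (hw'.pair (const _ 0))))).congr fun p => ?_
    rw [flag_recOfCode]
    simp only [decide_eq_true_eq]
  -- scope
  have hctx : CodeFP (pairE rdE natE) wnE (fun p => (p.1.1, p.1.2.1)) := hwl.pair hNu
  have hws : CodeFP (pairE rdE natE) (rawE natE) (fun p => p.1.1.getD (p.2 - p.1.2.1) []) := wlGetFP.comp (hwl.pair ht)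
  have hw0 : CodeFP (pairE rdE natE) natE (fun p => (p.1.1.getD (p.2 - p.1.2.1) []).getD 0 0) := (rawGetD natE (d := 0) rfl).comp (hws.pair (const _ 0))
  have hw1 : CodeFP (pairE rdE natE) natE (fun p => (p.1.1.getD (p.2 - p.1.2.1) []).getD 1 0) := (rawGetD natE (d := 0) rfl).comp (hws.pair (const _ 1))
  have ht1 : CodeFP (pairE rdE natE) natE (fun p => p.2 - p.1.2.1 + 1) := natAdd.comp (ht.pair (const _ 1))
  have sc := fun {fw ft : (List (List ℕ) × (ℕ × (List ℕ × List Bool))) × ℕ → ℕ} (hfw : CodeFP (pairE rdE natE) natE fw)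
      (hft : CodeFP (pairE rdE natE) natE ft) => segNumCanonFP.comp (hctx.pair (hfw.pair hft))
  have hi0 := sc hw0 ht
  have ho0 := sc hw0 ht1
  have hi1 := sc hw1 ht
  have ho1 := sc hw1 ht1
  have hsIn0 := (rawSingleton natE).comp (segNumFP.comp (hctx.pair (hc.pair (const _ 0))))
  have hsOut0 := (rawSingleton natE).comp (sc hw' hT)
  have hs12_0 := (rawCons natE).comp (hi0.pair ((rawSingleton natE).comp ho0))
  have hs4_0 := (rawCons natE).comp (hi0.pair ((rawCons natE).comp (hi1.pair ((rawCons natE).comp (ho0.pair ((rawSingleton natE).comp ho1))))))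
  have hk123 : CodeFP (pairE rdE natE) bitE (fun p => decide (p.1.2.2.1.getD (p.2 - p.1.2.1) 6 = 1 ∨
      p.1.2.2.1.getD (p.2 - p.1.2.1) 6 = 2 ∨ p.1.2.2.1.getD (p.2 - p.1.2.1) 6 = 3)) :=
    ((hkEq 1).or ((hkEq 2).or (hkEq 3))).congr fun p => by simp [Bool.decide_or]
  have hscope0 := h1.ite hsIn0 (h2.ite (hk123.ite hs12_0 ((hkEq 4).ite hs4_0 (const _ []))) hsOut0)
  have hscope : CodeFP (pairE rdE natE) (rawE natE) (fun p => (recOfCode p.1.1 p.1.2.1 p.1.2.2.1 p.1.2.2.2 p.2).scope) := by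
    refine hscope0.congr fun p => ?_
    rw [scope_recOfCode]
    simp only [decide_eq_true_eq]
  -- assemble the code of the record
  obtain ⟨F, hF, hFd⟩ := hkind.pair (hflag.pair hscope)
  exact ⟨F, hF, fun p => by rw [hFd]; rfl⟩

/-- **The record list on codes** (input `data = (wl, (N, (ops, xb)))`). [cite: AroraBarak2009, §1.3] -/
theorem recListLFP : CodeFP rdE (rawE NodeRec.recE) (fun d => recListL d.1 d.2.1 d.2.2.1 d.2.2.2) := by
  have hlen : CodeFP rdE unE (fun d => 2 * d.2.1 + d.1.length) :=
    (unAdd.comp ((unAdd.comp ((snd _ _).fst'.pair (snd _ _).fst')).pair ((ulength _).comp (fst _ _)))).congr fun d => by ring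
  have hm := map recOfCodeFP
  exact (hm.comp ((CodeFP.id rdE).pair (urange.comp hlen))).congr fun d => rfl

/-! ### The engine on its input -/

/-- **The typed input of the engine**: `(x, ((n, (m, gate items)), ((parents, bag code lists), y)))`,
whose code is `⟨x, ⟨sigmaEncode ⟨n, m, C⟩, ⟨D.encode, y⟩⟩⟩`. [folklore] -/
abbrev EIn : Type := List Bool × ((ℕ × (ℕ × List SGate)) × ((List ℕ × List (List ℕ)) × List Bool))

/-- The code of the engine's input. [folklore] -/
abbrev einE : EIn → List Bool :=
  pairE strE (pairE (pairE natE (pairE unE (rawE sgateE))) (pairE (pairE (listE natE) (listE (listE natE))) strE))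

/-- The wire lists of the input's gates. [folklore] -/
def wlIn (q : EIn) : List (List ℕ) := q.2.1.2.2.map fun g => wireListOf g.2

/-- The kinds of the input's gates. [folklore] -/
def opsIn (q : EIn) : List ℕ := q.2.1.2.2.map fun g => opKind g.2

/-- **The engine as a typed function**: `engineOut` on the data of the input. [cite: MarkovShi2008, §4 (Thm 4.6)] -/
def engineT (q : EIn) : ℤ × (ℤ × ℤ) :=
  engineOut (wlIn q) (q.1.length + q.2.1.2.1) (opsIn q) q.1 q.2.2.1.1 q.2.2.1.2 (capOf q.2.2.2)

/-- **The engine is computed on codes in polynomial time.** [cite: MarkovShi2008, §4 (Thm 4.6: "T^{O(1)} exp[O(tw)]")] [cite: AroraBarak2009, §1.3] -/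
theorem engineTFP : CodeFP einE (pairE intE (pairE intE intE)) engineT := by
  -- the data
  have hx : CodeFP einE strE (fun q => q.1) := fst _ _
  have hm : CodeFP einE unE (fun q => q.2.1.2.1) := (snd _ _).fst'.snd'.fst'
  have hgates : CodeFP einE (rawE sgateE) (fun q => q.2.1.2.2) := (snd _ _).fst'.snd'.snd'
  have hpars : CodeFP einE (rawE natE) (fun q => q.2.2.1.1) := (rawOfList natE).comp (snd _ _).snd'.fst'.fst'
  have hbags : CodeFP einE (rawE (rawE natE)) (fun q => q.2.2.1.2) := by
    have h1 : CodeFP einE (rawE (listE natE)) (fun q => q.2.2.1.2) := (rawOfList (listE natE)).comp (snd _ _).snd'.fst'.snd'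
    have hm := map (σ := Unit) (eσ := unitE) (eα := listE natE) (eβ := rawE natE) (g := fun t => t.2) ((rawOfList natE).comp (snd _ _))
    exact (hm.comp ((const _ ()).pair h1)).congr fun q => by simp
  have hy : CodeFP einE strE (fun q => q.2.2.2) := (snd _ _).snd'.snd'
  have hN : CodeFP einE unE (fun q => q.1.length + q.2.1.2.1) := unAdd.comp ((strLength.comp hx).pair hm)
  have hwl : CodeFP einE (rawE (rawE natE)) wlIn := by
    have hmap := map (σ := Unit) (eσ := unitE) (eα := sgateE) (eβ := rawE natE) (g := fun t => wireListOf t.2.2) (wireListOfFP.comp (snd _ _))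
    exact (hmap.comp ((const _ ()).pair hgates)).congr fun q => rfl
  have hops : CodeFP einE (rawE natE) opsIn := by
    have hmap := map (σ := Unit) (eσ := unitE) (eα := sgateE) (eβ := natE) (g := fun t => opKind t.2.2) (opKindFP.comp (snd _ _))
    exact (hmap.comp ((const _ ()).pair hgates)).congr fun q => rfl
  -- the budget
  have hunits : CodeFP einE (rawE unitE) (fun q => List.replicate (capOf q.2.2.2) ()) := by
    have hp : CodeFP einE (rawE unitE) (fun q => List.replicate (q.2.2.2.length ^ 10) ()) := (unitsPow 10).comp (strLength.comp hy)
    refine ((unitsMul.comp ((const _ (List.replicate 1024 ())).pair hp)).congr fun q => ?_)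
    simp only [List.length_replicate, capOf]
  -- the instance of the junction tree
  have hsegBags0 := (map segBagOfFP).comp ((hwl.pair hN).pair hbags)
  have hsegBags : CodeFP einE (rawE (rawE natE)) (fun q => q.2.2.1.2.map (segBagOf (wlIn q) (q.1.length + q.2.1.2.1))) :=
    hsegBags0.congr fun _ => rfl
  have hrecs0 := recListLFP.comp (hwl.pair (hN.pair (hops.pair hx)))
  have hrecs : CodeFP einE (rawE NodeRec.recE) (fun q => recListL (wlIn q) (q.1.length + q.2.1.2.1) (opsIn q) q.1) := hrecs0.congr fun _ => rfl
  have hinst := hunits.pair (hpars.pair (hsegBags.pair hrecs))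
  have hdp0 := (dpValueFP (O := NodeRec.recOps) (eΦ := NodeRec.recE) codeRing_zo NodeRec.codeFactors_rec
    (fun φ a => NodeRec.cn_feval_le φ a) le_rfl (d := 4) (by norm_num)).comp hinst
  have hZ : CodeFP einE zoE (fun q => engineZ (wlIn q) (q.1.length + q.2.1.2.1) (opsIn q) q.1 q.2.2.1.1 q.2.2.1.2 (capOf q.2.2.2)) :=
    hdp0.congr fun q => by simp only [List.length_replicate]; rfl
  -- the output
  have hco := coordsFP.comp hZ
  have hu := intMul.comp ((const einE (2 : ℤ)).pair hco.fst'.fst')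
  have hv := intSub.comp (hco.snd'.fst'.pair hco.snd'.snd')
  have hcount : CodeFP einE natE (fun q => hCountOps (opsIn q)) := (rawCountNat.comp ((const _ 1).pair hops)).congr fun _ => rfl
  have hexp : CodeFP einE unE (fun q => hCountOps (opsIn q) + 1) := by
    refine ((unOfNatMin.comp ((unSucc.comp ((ulength _).comp hops)).pair (natAdd.comp (hcount.pair (const _ 1))))).congr fun q => ?_)
    show min (hCountOps (opsIn q) + 1) ((opsIn q).length + 1) = hCountOps (opsIn q) + 1
    exact min_eq_left (Nat.succ_le_succ List.count_le_length)
  have hthird := intPow.comp ((const einE (2 : ℤ)).pair hexp)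
  have hzero : CodeFP einE bitE (fun q => decide (q.1.length + q.2.1.2.1 = 0)) := natEq.comp ((natOfUn.comp hN).pair (const _ 0))
  have hres := hzero.ite (const _ (((0 : ℤ), ((0 : ℤ), (1 : ℤ))))) (hu.pair (hv.pair hthird))
  refine hres.congr fun q => ?_
  simp only [engineT, engineOut, decide_eq_true_eq]

end EngineFP

open EngineFP

/-- A code-computed map has a string function. [folklore] -/
theorem CodeFP_fn {α β : Type} {eα : α → List Bool} {eβ : β → List Bool} {g : α → β} (h : CodeFP eα eβ g) :
    ∃ f : List Bool → List Bool, f ∈ FP ∧ ∀ a, f (eα a) = eβ (g a) := by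
  obtain ⟨f, hf, hfg⟩ := h
  exact ⟨f, hf, hfg⟩

/-- **The contraction engine** (Steps 1, 3, 4 of the proof of Markov–Shi's Thm 4.6, as the
interface `ContractionEngine` of `TensorNetworkContractionAssembly.lean`): the junction-tree
evaluation over `ℤ[ω]` of the integer records of the segment network along the supplied rooted
decomposition, in polynomial time (`engineTFP`), correct by `engineOut_spec`.
[cite: MarkovShi2008, §4 (Thm 4.6 and its proof; Prop 4.2, Lemma 4.4), §3 (Prop 3.5, Def 3.2)] -/
def jtEngine : ContractionEngine where
  fn := Classical.choose (CodeFP_fn engineTFP)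
  mem_FP := (Classical.choose_spec (CodeFP_fn engineTFP)).1
  spec := by
    intro x m C hC k D y hy
    obtain ⟨u, v, h, hout, hp⟩ := engineOut_spec x m hC D hy
    refine ⟨u, v, h, ?_, hp⟩
    have hin : boolPair x (boolPair (QCircuit.sigmaEncode (G := cliffordT) ⟨x.length, m, C⟩) (boolPair D.encode y)) =
        einE ((x, ((x.length, (m, C.gates.map fun g => (⟨_, g⟩ : SGate))), ((D.rparList, D.rbagList CircuitNode.code), y))) : EIn) := by
      rw [QCircuit.sigmaEncode_eq, QCircuit.encode_eq_encList, encode_eq_lists]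
      simp only [einE, pairE_apply, rawE, List.map_map, listE]
      rfl
    rw [hin, (Classical.choose_spec (CodeFP_fn engineTFP)).2]
    have hwl : wlIn ((x, ((x.length, (m, C.gates.map fun g => (⟨_, g⟩ : SGate))), ((D.rparList, D.rbagList CircuitNode.code), y))) : EIn) =
        wlOf C := by simp [wlIn, wlOf, List.map_map]
    have hops : opsIn ((x, ((x.length, (m, C.gates.map fun g => (⟨_, g⟩ : SGate))), ((D.rparList, D.rbagList CircuitNode.code), y))) : EIn) =
        opsOf C := by simp [opsIn, opsOf, List.map_map]
    have ht : engineT ((x, ((x.length, (m, C.gates.map fun g => (⟨_, g⟩ : SGate))), ((D.rparList, D.rbagList CircuitNode.code), y))) : EIn) =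
        (u, (v, 2 ^ h)) := by
      rw [← hout, engineT, hwl, hops]
    rw [ht]
    rfl

/-- **Markov–Shi 2008, Theorem 4.6 (the decomposition of its Step 2 supplied), discharged**: a
language decided with bounded error by a uniform polynomial-size oracle-free Clifford+`T` family
with `FP`-supplied rooted tree decompositions of the circuit graphs of width `≤ c log₂ n + c` is
in `P` — by the contraction engine `jtEngine` and `markovShi2008_thm46_of_engine`.
[cite: MarkovShi2008, §4 (Thm 4.6)] -/
theorem markovShi2008_thm46_holds : markovShi2008_thm46 := markovShi2008_thm46_of_engine jtEngine

/-- **Markov–Shi 2008, Proposition 5.1 (the qubit indexing supplied), discharged**: with the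
ordering supplied, the rooted path decomposition of the printed proof is an `FP` function
(`exists_pathSupplier`), and Thm 4.6 (`markovShi2008_thm46_holds`) decides the language.
[cite: MarkovShi2008, §5 (Prop 5.1)] -/
theorem markovShi2008_prop51_holds : markovShi2008_prop51 := markovShi2008_prop51_of_thm46' markovShi2008_thm46_holds

end Literature.Barriers.QuantumAdvantage

end
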